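import Summits.QuantumFields.YangMills.Theorems.BalabanUVNodesN15KingModelToronOperator
import HarnessLib

/-!
# BalabanUVNodes ∕ N15 — THE KING-MODEL RUNG (PART Ͷ-d): THE HOLONOMY GAP OF THE MASSLESS TORON LAPLACIAN, EXACTLY —
# `λ₀(−cΔ_ω) = 2cΣ_μ(1 − cos(θ_μ∕K_μ))` (`ω_μ = e^{iθ_μ∕K_μ}`, `|θ_μ| ≤ π`: holonomy `e^{iθ_μ}`), attained on the constants; Jordan bounds `(4c∕π²)Σ(θ_μ∕K_μ)² ≤ λ₀ ≤ cΣ(θ_μ∕K_μ)²`;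
# `λ₀ > 0 ↔ θ ≠ 0` ↔ the toron is not a pure gauge (PART Ͱ-d by name); and ITS η-RATE `|λ₀ − cΣ_μ(θ_μ∕K_μ)²| ≤ (5∕48)·cΣ_μ(θ_μ∕K_μ)⁴` (= `O(η²)` in physical units)
# (Track A, DAG node N15 = NE2 «η-rates of the covariance pieces»; FAN-OUT v1.1 §N15 s3 «KING-MODEL RUNG … + what the curved case adds»; count-neutral)

HONEST FRAMING.  Count-neutral (cell `pub-ymgap`, seat `pub-ymgap-dag-n15-e` g44; `--supports stmt-QuantumFields-27247 --as helper` = K3ᴬ, KEY MAP v3).  One finite torus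
`T = Π_μℤ∕K_μ` at fixed spacing; King's `A = 0` model [King1986] is the comparison object (its massless operator has `λ₀ = 0`: the constants); constant abelian (flat) `U(1)` link
fields.  NOT Bałaban's `G_k(U)`, NOT [Balaban1985BackgroundPropagators] (3.42); NOT a node discharge (N15 of record untouched); nothing continuum ∕ ℝ⁴ ∕ OS ∕ Clay.

WHAT THE CURVED CASE ADDS TO N15's FINE LAYER, QUANTITATIVELY.  PART Ͱ-d proved: for `U(1)` links the massless covariant Laplacian is positive definite iff `U` is not a pure
gauge.  At a toron the bottom of the spectrum is COMPUTED: with the reduced holonomy angles `θ_μ ∈ [−π, π]` (every toron is gauge equivalent to one of these, PART Ͷ-c) and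
`φ_μ = θ_μ∕K_μ`, the twisted symbol `lapSymTw K c 0 φ q = cΣ_μ(2 − 2cos(p′_μ(q) + θ_μ∕K_μ))` is MINIMAL AT `q = 0` — the constants are the ground state of `−cΔ_ω` in the constant
gauge — with value `holonomyGap K c θ := 2cΣ_μ(1 − cos(θ_μ∕K_μ))`.  PROVED HERE:
* §1 trigonometry: ★ `cos_two_pi_int_div_add_le` (`cos(2πj∕K + φ) ≤ cos φ` for `j ∈ ℤ`, `K ≥ 1`, `|φ| ≤ π∕K` — the rigidly shifted grid `{(2πj + θ)∕K}` is nowhere closer to `2πℤ`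
  than at `j = 0`), `abs_two_mul_one_sub_cos_sub_sq_le` (`|2(1−cos t) − t²| ≤ (5∕48)t⁴`, `|t| ≤ 1`; Jordan's two-sided bound is Mathlib's `Real.cos_le_one_sub_mul_cos_sq` ∕
  `Real.one_sub_sq_div_two_le_cos`, used inline);
* §2 `holonomyGap`, `lapSymTw_reduced_zero` (the symbol at `q = 0` IS the gap), ★★★ **`holonomyGap_le_lapSymTw`** (`|θ_μ| ≤ π ⇒ holonomyGap ≤ lapSymTw(θ∕K, q)` for EVERY `q`),
  ★★★ **`form_toronOp_ge_holonomyGap`** (`(m² + holonomyGap)·Σ_x|v_x|² ≤ Re(v^*(−cΔ_ω+m²)v)` for every `v`, every `m²`; PART Ͷ-a's spectral resolution), ★★ **`form_toronOp_const`**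
  (EQUALITY on the constants: the bound is the bottom of the spectrum), `holonomyGap_nonneg`, ★ `holonomyGap_pos_iff` (`> 0 ↔ θ ≠ 0`), ★★ `toronOp_massless_posDef_iff`
  (`−cΔ_ω` positive definite iff `θ ≠ 0`, `c > 0`) and — PART Ͱ-d `posDef_covLapF_massless_iff` BY NAME — ★★ **`toronLink_pureGauge_iff`**: the toron with reduced angles `θ` is a
  pure gauge iff `θ = 0` (non-trivial holonomy is not a gauge artefact);
* §3 ★★ `holonomyGap_ge_sq` ∕ `holonomyGap_le_sq` — `(4c∕π²)Σ_μ(θ_μ∕K_μ)² ≤ holonomyGap ≤ cΣ_μ(θ_μ∕K_μ)²`: the gap is quadratic in the holonomy angle and of order `K⁻²` (an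
  infrared scale: `1∕(side length)²`);
* §4 THE η-RATE (N15's currency): ★★★ **`abs_holonomyGap_sub_continuum_le`** — `|holonomyGap K c θ − cΣ_μ(θ_μ∕K_μ)²| ≤ (5∕48)·c·Σ_μ(θ_μ∕K_μ)⁴` whenever `|θ_μ| ≤ K_μ`; in physical
  units (`c = η⁻²`, `K_μ = ℓ_μ∕η`) the continuum twisted Laplacian `−(∇ − iA)²`, `A_μ = θ_μ∕ℓ_μ`, has bottom `Σ_μ(θ_μ∕ℓ_μ)²` and the lattice gap converges to it at rate
  `(5∕48)η²Σ_μ(θ_μ∕ℓ_μ)⁴ = O(η²)`; ★★ `abs_lapSymTw_sub_continuum_le` — the same for EVERY level: `|lapSymTw K c m² φ q − (m² + cΣ_μ(p′_μ(q)+φ_μ)²)| ≤ (5∕48)cΣ_μ(p′_μ(q)+φ_μ)⁴`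
  (the twisted dispersion relation at rate `η²`, momenta `|p′+φ| ≤ 1` in lattice units).

PRIOR TREE ART (by name, not restated): Ͷ-a (`toronOp`, `toronLink`, `lapSymTw`, `form_toronOp_ge_of_le`, `form_toronOp_chi`, `sum_norm_sq_chi`, `toronOp_isHermitian`, `norm_twistOf_eq_one`,
`toronLink_mem_unitaryGroup`, `siteEquiv`), Ͱ-d `posDef_covLapF_massless_iff`, Ͱ-a `kingGaugeAct`, `B5Prop11Plancherel` (`sOf`, `sOf_zero`, `chi`, `abs_sOf_le`), `B5ToronMomentum161.twistOf`,
Mathlib (`Real.cos_le_cos_of_nonneg_of_le_pi`, `Real.cos_sub_int_mul_two_pi`, `Real.cos_le_one_sub_mul_cos_sq`, `Real.one_sub_sq_div_two_le_cos`, `Real.cos_bound`, `Matrix.PosDef.of_dotProduct_mulVec_pos`).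
Dedup (rg at filing): basename 0 files; needles `holonomyGap|cos_two_pi_int_div_add_le|toronLink_pureGauge_iff|form_toronOp_ge_holonomyGap` 0 tree files; the dry-run's near-duplicate
notes on stand-alone Jordan lemmas (`…QCD….sq_le_one_sub_cos`, `…LatticeQCDFlow….two_mul_one_sub_cos_le_sq`) answered by NOT declaring them (Mathlib's bounds used inline).
presearch: «lowest eigenvalue of the discrete magnetic Laplacian with constant vector potential on a torus ∕ twisted boundary conditions» → folklore (Bloch∕Floquet; 't Hooft 1979
twisted b.c. = [tHooft1979Flux] NPB 153, notion only; [DodziukMathai2006] Cor 1.3 gives only `λ₀(Δ) ≤ λ₀(Δ_σ)`) — the closed form, its sharpness and its η-rate are PROVED here.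
v1.1 (DOC-ONLY, ERRATA Ͷ1∕Ͷ2, referee ref-I READ-1022 LOCATED-1): bib key `tHooft1979Flux` (NPB 153) replaces `tHooft1979` (Erice lectures); King's dispersion η-rate is (4.7)–(4.10)
p.671 («x² ≥ sin²x ≥ x² − x⁴∕3 … |Δ_η(p) − (|p|² + m²(L^kε)²)| ≤ Cη²Σ|p_μ|⁴»), not «(3.42)–(3.43) p.659» as v1.0's §4 docstrings said; declarations byte-identical to v1.0.  Locators: [King1986] (4.4) p.670, (4.35)
p.674; [Balaban1985BackgroundPropagators] (3.3) p.391, (3.23) p.394; [Balaban1984PropagatorsI] (1.31) p.23; [DodziukMathai2006] §1 Cor 1.3.  0 `sorry`, 1 `def` (`holonomyGap`).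
-/

noncomputable section

open scoped BigOperators ComplexConjugate ComplexOrder
open Finset Matrix Complex

namespace Summit.QuantumFields.YangMills.BalabanUVNodes.N15KingModelRung.Toron

open Literature.MathematicalPhysics.QuantumFieldTheory.LatticeDiamagneticInequality (Hopping)
open Literature.MathematicalPhysics.QuantumFieldTheory.Balaban1983to89.B5Prop11Plancherel
open Literature.MathematicalPhysics.QuantumFieldTheory.Balaban1983to89.B5ToronMomentum161 (twistOf)
open Literature.MathematicalPhysics.QuantumFieldTheory.King1986.Torus (lapF lapSym)
open Summit.QuantumFields.YangMills.BalabanUVNodes.N15KingModelRung.Covariant (covLapF kingGaugeAct posDef_covLapF_massless_iff)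

/-! ## §1 Trigonometric lemmas: the shifted grid, Jordan's inequality, the quartic remainder -/

section Trig

/-- ★ THE SHIFTED GRID IS NOWHERE CLOSER TO `2πℤ` THAN AT `j = 0`: for `K ≥ 1`, `j ∈ ℤ` and `|φ| ≤ π∕K`, `cos(2πj∕K + φ) ≤ cos φ`. [folklore] -/
theorem cos_two_pi_int_div_add_le {K : ℕ} (hK : 0 < K) (j : ℤ) {φ : ℝ} (hφ : |φ| ≤ Real.pi / K) :
    Real.cos (2 * Real.pi * j / K + φ) ≤ Real.cos φ := by
  have hKr : (0 : ℝ) < K := by exact_mod_cast hK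
  have hπ := Real.pi_pos
  set t : ℝ := 2 * Real.pi * j / K + φ with ht
  -- reduce `t` modulo `2π` into `[-π, π)`
  set n : ℤ := ⌊(t + Real.pi) / (2 * Real.pi)⌋ with hn
  set s : ℝ := t - n * (2 * Real.pi) with hs
  have hs1 : -Real.pi ≤ s := by
    have h1 : (n : ℝ) ≤ (t + Real.pi) / (2 * Real.pi) := Int.floor_le _
    have h2 : (n : ℝ) * (2 * Real.pi) ≤ t + Real.pi := by rwa [le_div_iff₀ (by positivity)] at h1
    rw [hs]; linarith
  have hs2 : s < Real.pi := by
    have h1 : (t + Real.pi) / (2 * Real.pi) < n + 1 := Int.lt_floor_add_one _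
    have h2 : t + Real.pi < ((n : ℝ) + 1) * (2 * Real.pi) := by rwa [div_lt_iff₀ (by positivity)] at h1
    rw [hs]; linarith
  have hcos : Real.cos t = Real.cos s := by rw [hs, Real.cos_sub_int_mul_two_pi]
  -- `s = 2π j'/K + φ` with `j' = j - nK`
  set j' : ℤ := j - n * K with hj'
  have hs' : s = 2 * Real.pi * j' / K + φ := by
    rw [hs, ht, hj']; push_cast; field_simp; ring
  rw [hcos]
  have hφπ : |φ| ≤ Real.pi := le_trans hφ (div_le_self hπ.le (by exact_mod_cast hK))
  by_cases hj0 : j' = 0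
  · rw [hs', hj0]; simp
  · -- `|s| ≥ 2π/K - |φ| ≥ π/K ≥ |φ|`
    have hj1 : (1 : ℝ) ≤ |(j' : ℝ)| := by
      rw [← Int.cast_abs]; exact_mod_cast Int.one_le_abs hj0
    have hbig : Real.pi / K ≤ |s| := by
      have h1 : |2 * Real.pi * j' / K| ≥ 2 * Real.pi / K := by
        rw [abs_div, abs_mul, abs_of_pos (by positivity : (0:ℝ) < 2 * Real.pi), abs_of_pos hKr, ge_iff_le, div_le_div_iff_of_pos_right hKr]
        nlinarith
      have h2 : |s| ≥ |2 * Real.pi * j' / K| - |φ| := by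
        rw [hs']
        have := abs_add_le (2 * Real.pi * j' / K + φ) (-φ)
        rw [add_neg_cancel_right, abs_neg] at this
        linarith
      have h3 : 2 * Real.pi / K - Real.pi / K = Real.pi / K := by ring
      linarith [h1, h2]
    have hφs : |φ| ≤ |s| := le_trans hφ hbig
    have hsπ : |s| ≤ Real.pi := abs_le.mpr ⟨by linarith, hs2.le⟩
    rw [← Real.cos_abs s, ← Real.cos_abs φ]
    exact Real.cos_le_cos_of_nonneg_of_le_pi (abs_nonneg φ) hsπ hφs

/-- THE QUARTIC REMAINDER: `|2(1 − cos t) − t²| ≤ (5∕48)t⁴` for `|t| ≤ 1`. [folklore] -/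
theorem abs_two_mul_one_sub_cos_sub_sq_le {t : ℝ} (ht : |t| ≤ 1) : |2 * (1 - Real.cos t) - t ^ 2| ≤ 5 / 48 * t ^ 4 := by
  have h := Real.cos_bound ht
  rw [show |t| ^ 4 = t ^ 4 by rw [← abs_pow, abs_of_nonneg (by positivity)]] at h
  have : 2 * (1 - Real.cos t) - t ^ 2 = -2 * (Real.cos t - (1 - t ^ 2 / 2)) := by ring
  rw [this, abs_mul, abs_neg, abs_two]
  linarith

end Trig

/-! ## §2 The holonomy gap: the bottom of the spectrum of `−cΔ_ω + m²` -/

section Gap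

variable {d : ℕ} (K : Fin (d + 1) → ℕ)

/-- THE HOLONOMY GAP `2cΣ_μ(1 − cos(θ_μ∕K_μ))` of the toron with holonomy angles `θ_μ` (reduced: `|θ_μ| ≤ π`) — the lowest eigenvalue of the massless twisted Laplacian `−cΔ_ω`,
`ω_μ = e^{iθ_μ∕K_μ}` (Theorem `form_toronOp_ge_holonomyGap` + `form_toronOp_const`). [cite: King1986, (4.4) p.670; tHooft1979Flux, NPB 153 (twisted boundary conditions)] -/
def holonomyGap (c : ℝ) (θ : Fin (d + 1) → ℝ) : ℝ := 2 * c * ∑ μ, (1 - Real.cos (θ μ / K μ))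

/-- The reduced phases `φ_μ = θ_μ∕K_μ` of the holonomy angles. -/
abbrev redPhase (θ : Fin (d + 1) → ℝ) : Fin (d + 1) → ℝ := fun μ => θ μ / K μ

variable [hK : ∀ μ, NeZero (K μ)]

/-- `0 < K_μ` as a real number. [folklore] -/
theorem period_pos (μ : Fin (d + 1)) : (0 : ℝ) < K μ := by exact_mod_cast Nat.pos_of_ne_zero (NeZero.ne _)

omit hK in
/-- THE SYMBOL AT ZERO MOMENTUM IS THE GAP: `lapSymTw K c m² (θ∕K) 0 = m² + holonomyGap K c θ`. [cite: King1986, (4.4) p.670] -/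
theorem lapSymTw_reduced_zero (c m2 : ℝ) (θ : Fin (d + 1) → ℝ) : lapSymTw K c m2 (redPhase K θ) 0 = m2 + holonomyGap K c θ := by
  simp only [lapSymTw, holonomyGap, redPhase, sOf_zero, Pi.zero_apply, zero_add]
  rw [mul_assoc, Finset.mul_sum, Finset.mul_sum, Finset.mul_sum]
  congr 1
  refine Finset.sum_congr rfl fun μ _ => ?_
  ring

/-- ★★★ **THE GAP IS THE MINIMUM OF THE TWISTED SYMBOL**: for reduced angles `|θ_μ| ≤ π` and EVERY momentum `q`, `m² + holonomyGap ≤ lapSymTw K c m² (θ∕K) q`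
(`c ≥ 0`; per direction the shifted grid `{(2πj+θ_μ)∕K_μ}` is nowhere closer to `2πℤ` than at `j = 0`). [cite: King1986, (4.4) p.670; tHooft1979Flux, NPB 153 (twisted boundary conditions)] -/
theorem holonomyGap_le_lapSymTw {c : ℝ} (hc : 0 ≤ c) (m2 : ℝ) {θ : Fin (d + 1) → ℝ} (hθ : ∀ μ, |θ μ| ≤ Real.pi) (q : Tor K) :
    m2 + holonomyGap K c θ ≤ lapSymTw K c m2 (redPhase K θ) q := by
  unfold holonomyGap lapSymTw
  have hsum : ∑ μ, (2 - 2 * Real.cos (θ μ / K μ)) ≤ ∑ μ, (2 - 2 * Real.cos (sOf K q μ + redPhase K θ μ)) := by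
    refine Finset.sum_le_sum fun μ _ => ?_
    have hKμ : 0 < K μ := Nat.pos_of_ne_zero (NeZero.ne _)
    have hφ : |θ μ / K μ| ≤ Real.pi / K μ := by
      rw [abs_div, abs_of_pos (period_pos K μ)]
      exact div_le_div_of_nonneg_right (hθ μ) (period_pos K μ).le
    have h := cos_two_pi_int_div_add_le hKμ ((q μ).valMinAbs) hφ
    have hs : sOf K q μ + redPhase K θ μ = 2 * Real.pi * ((q μ).valMinAbs : ℤ) / K μ + θ μ / K μ := by
      simp only [sOf, redPhase]
    rw [hs]
    linarith
  have h2 : 2 * c * ∑ μ, (1 - Real.cos (θ μ / K μ)) = c * ∑ μ, (2 - 2 * Real.cos (θ μ / K μ)) := by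
    rw [Finset.mul_sum, Finset.mul_sum]; exact Finset.sum_congr rfl fun μ _ => by ring
  rw [h2]
  have := mul_le_mul_of_nonneg_left hsum hc
  linarith

/-- ★★★ **COERCIVITY AT THE GAP**: `(m² + holonomyGap)·Σ_x|v_x|² ≤ Re(v^*(−cΔ_ω + m²)v)` for every `v : T → ℂ` (`ω = e^{iθ∕K}`, reduced angles, `c ≥ 0`, any `m²`).
[cite: King1986, (4.35) p.674; Balaban1985BackgroundPropagators, (3.23) p.394] -/
theorem form_toronOp_ge_holonomyGap {c : ℝ} (hc : 0 ≤ c) (m2 : ℝ) {θ : Fin (d + 1) → ℝ} (hθ : ∀ μ, |θ μ| ≤ Real.pi) (v : Tor K → ℂ) :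
    (m2 + holonomyGap K c θ) * ∑ x, ‖v x‖ ^ 2 ≤ (star v ⬝ᵥ (toronOp K c m2 (twistOf (redPhase K θ)) *ᵥ v)).re :=
  form_toronOp_ge_of_le K hc m2 (redPhase K θ) (holonomyGap_le_lapSymTw K hc m2 hθ) v

/-- ★★ **THE BOUND IS ATTAINED ON THE CONSTANTS** (the plane wave `q = 0`): `Re(1^*(−cΔ_ω+m²)1) = (m² + holonomyGap)·|T|` — in the constant gauge the constants are the
ground state of the toron operator, so `m² + holonomyGap` IS the bottom of the spectrum. [cite: King1986, (4.35) p.674] -/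
theorem form_toronOp_const (c m2 : ℝ) (θ : Fin (d + 1) → ℝ) :
    star (chi K 0) ⬝ᵥ (toronOp K c m2 (twistOf (redPhase K θ)) *ᵥ chi K 0) = (((m2 + holonomyGap K c θ) * Fintype.card (Tor K) : ℝ) : ℂ) := by
  rw [form_toronOp_chi, lapSymTw_reduced_zero]; push_cast; ring

/-- The constant plane wave `χ_0 ≡ 1`. [folklore] -/
theorem chi_zero_eq_one : chi K (0 : Tor K) = fun _ => 1 := by
  funext x; exact chi_zero_left K x

/-- ★★ SHARPNESS restated on `Σ_x|v_x|²`: for `v ≡ 1`, `Re(v^*Mv) = (m² + holonomyGap)·Σ_x|v_x|²`. [cite: King1986, (4.35) p.674] -/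
theorem form_toronOp_one (c m2 : ℝ) (θ : Fin (d + 1) → ℝ) :
    (star (fun _ : Tor K => (1 : ℂ)) ⬝ᵥ (toronOp K c m2 (twistOf (redPhase K θ)) *ᵥ fun _ => (1 : ℂ))).re
      = (m2 + holonomyGap K c θ) * ∑ x : Tor K, ‖(fun _ : Tor K => (1 : ℂ)) x‖ ^ 2 := by
  rw [← chi_zero_eq_one, form_toronOp_const, sum_norm_sq_chi]; norm_cast

omit hK in
/-- `holonomyGap ≥ 0` (`c ≥ 0`). [folklore] -/
theorem holonomyGap_nonneg {c : ℝ} (hc : 0 ≤ c) (θ : Fin (d + 1) → ℝ) : 0 ≤ holonomyGap K c θ := by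
  unfold holonomyGap
  exact mul_nonneg (by positivity) (Finset.sum_nonneg fun μ _ => by linarith [Real.cos_le_one (θ μ / K μ)])

/-- For reduced angles, `1 − cos(θ_μ∕K_μ) = 0 ↔ θ_μ = 0`. [folklore] -/
theorem one_sub_cos_redPhase_eq_zero_iff {θ : Fin (d + 1) → ℝ} (hθ : ∀ μ, |θ μ| ≤ Real.pi) (μ : Fin (d + 1)) :
    1 - Real.cos (θ μ / K μ) = 0 ↔ θ μ = 0 := by
  constructor
  · intro h
    have hφ : |θ μ / K μ| ≤ Real.pi := by
      rw [abs_div, abs_of_pos (period_pos K μ)]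
      exact le_trans (div_le_self (abs_nonneg _) (by exact_mod_cast Nat.pos_of_ne_zero (NeZero.ne (K μ)))) (hθ μ)
    have hj := Real.cos_le_one_sub_mul_cos_sq hφ
    have hcos : Real.cos (θ μ / K μ) = 1 := by linarith
    rw [hcos] at hj
    have hpos : (0 : ℝ) < 2 / Real.pi ^ 2 := by positivity
    have hx2 : (θ μ / K μ) ^ 2 ≤ 0 := by
      by_contra hcon
      linarith [mul_pos hpos (not_le.mp hcon)]
    have : θ μ / K μ = 0 := pow_eq_zero_iff (n := 2) two_ne_zero |>.mp (le_antisymm hx2 (sq_nonneg _))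
    rcases div_eq_zero_iff.mp this with h0 | h0
    · exact h0
    · exact absurd h0 (period_pos K μ).ne'
  · intro h; rw [h, zero_div, Real.cos_zero, sub_self]

/-- ★ `holonomyGap > 0 ↔ θ ≠ 0` (reduced angles, `c > 0`): a non-trivial holonomy in ANY direction opens a gap. [cite: DodziukMathai2006, §1 Cor 1.3; tHooft1979Flux, NPB 153 (twisted boundary conditions)] -/
theorem holonomyGap_pos_iff {c : ℝ} (hc : 0 < c) {θ : Fin (d + 1) → ℝ} (hθ : ∀ μ, |θ μ| ≤ Real.pi) : 0 < holonomyGap K c θ ↔ θ ≠ 0 := by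
  have hterm : ∀ μ, 0 ≤ 1 - Real.cos (θ μ / K μ) := fun μ => by linarith [Real.cos_le_one (θ μ / K μ)]
  unfold holonomyGap
  rw [mul_pos_iff_of_pos_left (by positivity), Finset.sum_pos_iff_of_nonneg fun μ _ => hterm μ]
  constructor
  · rintro ⟨μ, -, hμ⟩ hθ0
    rw [hθ0, Pi.zero_apply, zero_div, Real.cos_zero, sub_self] at hμ
    exact lt_irrefl _ hμ
  · intro hne
    obtain ⟨μ, hμ⟩ := Function.ne_iff.mp hne
    refine ⟨μ, Finset.mem_univ _, lt_of_le_of_ne (hterm μ) fun h => hμ ?_⟩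
    exact (one_sub_cos_redPhase_eq_zero_iff K hθ μ).mp h.symm

/-- ★★ **THE MASSLESS TORON LAPLACIAN IS POSITIVE DEFINITE IFF THE HOLONOMY IS NON-TRIVIAL** (`c > 0`, reduced angles): `(−cΔ_ω).PosDef ↔ θ ≠ 0`.
[cite: DodziukMathai2006, §1 Cor 1.3; Balaban1985BackgroundPropagators, (3.23) p.394] -/
theorem toronOp_massless_posDef_iff {c : ℝ} (hc : 0 < c) {θ : Fin (d + 1) → ℝ} (hθ : ∀ μ, |θ μ| ≤ Real.pi) :
    (toronOp K c 0 (twistOf (redPhase K θ))).PosDef ↔ θ ≠ 0 := by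
  constructor
  · intro hpd hθ0
    subst hθ0
    have h := hpd.re_dotProduct_pos (x := chi K 0) (by
      intro h0; have := congr_fun h0 0; rw [chi_zero_left] at this; exact one_ne_zero this)
    rw [form_toronOp_const] at h
    simp [holonomyGap] at h
  · intro hne
    have hgap := (holonomyGap_pos_iff K hc hθ).mpr hne
    refine Matrix.PosDef.of_dotProduct_mulVec_pos (toronOp_isHermitian K c 0 _) fun v hv => ?_
    have hform := form_toronOp_ge_holonomyGap K hc.le 0 hθ v
    rw [zero_add] at hform
    have hpos : 0 < ∑ x, ‖v x‖ ^ 2 := by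
      obtain ⟨x, hx⟩ := Function.ne_iff.mp hv
      exact lt_of_lt_of_le (by positivity : 0 < ‖v x‖ ^ 2) (Finset.single_le_sum (fun y _ => sq_nonneg ‖v y‖) (Finset.mem_univ x))
    have hre : 0 < (star v ⬝ᵥ (toronOp K c 0 (twistOf (redPhase K θ)) *ᵥ v)).re := lt_of_lt_of_le (mul_pos hgap hpos) hform
    have him : (star v ⬝ᵥ (toronOp K c 0 (twistOf (redPhase K θ)) *ᵥ v)).im = 0 := form_toronOp_im K hc.le 0 _ v
    exact (RCLike.pos_iff (K := ℂ)).mpr ⟨by simpa using hre, by simpa using him⟩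

/-- The toron operator on `T × Unit` and on `T` are positive definite together. [folklore] -/
theorem posDef_covLapF_toronLink_iff (c m2 : ℝ) (ω : Fin (d + 1) → ℂ) :
    (covLapF K c m2 (toronLink K ω)).PosDef ↔ (toronOp K c m2 ω).PosDef := by
  constructor
  · intro h; rw [toronOp, Matrix.reindex_apply]; exact h.submatrix (siteEquiv K).symm.injective
  · intro h
    have h' := h.submatrix (e := siteEquiv K) (siteEquiv K).injective
    have : (toronOp K c m2 ω).submatrix (siteEquiv K) (siteEquiv K) = covLapF K c m2 (toronLink K ω) := by
      ext p q; rfl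
    rwa [this] at h'

/-- ★★ **NON-TRIVIAL HOLONOMY IS NOT A GAUGE ARTEFACT** (PART Ͱ-d by name): the toron with reduced angles `θ` is a pure gauge `g·1·g^*` (`g : T → U(1)`) iff `θ = 0` (`c > 0`).
[cite: Balaban1985BackgroundPropagators, p.398 l.19; DodziukMathai2006, §1 Cor 1.3; tHooft1979Flux, NPB 153 (twisted boundary conditions)] -/
theorem toronLink_pureGauge_iff {c : ℝ} (hc : 0 < c) {θ : Fin (d + 1) → ℝ} (hθ : ∀ μ, |θ μ| ≤ Real.pi) :
    (∃ g : Tor K → Matrix Unit Unit ℂ, (∀ x, g x ∈ Matrix.unitaryGroup Unit ℂ) ∧ toronLink K (twistOf (redPhase K θ)) = kingGaugeAct K g Hopping.free) ↔ θ = 0 := by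
  have h := posDef_covLapF_massless_iff K hc (toronLink_mem_unitaryGroup K (norm_twistOf_eq_one (redPhase K θ)))
  rw [posDef_covLapF_toronLink_iff, toronOp_massless_posDef_iff K hc hθ] at h
  constructor
  · intro hg; by_contra hne; exact (h.mp hne) hg
  · intro h0; by_contra hng; exact (h.mpr hng) h0

end Gap

/-! ## §3 The size of the gap: quadratic in the holonomy angle, of order `K⁻²` -/

section Size

variable {d : ℕ} (K : Fin (d + 1) → ℕ) [hK : ∀ μ, NeZero (K μ)]

/-- ★★ LOWER JORDAN BOUND: `(4c∕π²)·Σ_μ(θ_μ∕K_μ)² ≤ holonomyGap K c θ` (reduced angles, `c ≥ 0`). [folklore] -/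
theorem holonomyGap_ge_sq {c : ℝ} (hc : 0 ≤ c) {θ : Fin (d + 1) → ℝ} (hθ : ∀ μ, |θ μ| ≤ Real.pi) :
    4 * c / Real.pi ^ 2 * ∑ μ, (θ μ / K μ) ^ 2 ≤ holonomyGap K c θ := by
  unfold holonomyGap
  rw [show 4 * c / Real.pi ^ 2 * ∑ μ, (θ μ / K μ) ^ 2 = c * ∑ μ, 4 / Real.pi ^ 2 * (θ μ / K μ) ^ 2 by rw [Finset.mul_sum, Finset.mul_sum]; exact Finset.sum_congr rfl fun μ _ => by ring,
    show 2 * c * ∑ μ, (1 - Real.cos (θ μ / K μ)) = c * ∑ μ, 2 * (1 - Real.cos (θ μ / K μ)) by rw [Finset.mul_sum, Finset.mul_sum]; exact Finset.sum_congr rfl fun μ _ => by ring]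
  refine mul_le_mul_of_nonneg_left (Finset.sum_le_sum fun μ _ => ?_) hc
  have hφ : |θ μ / K μ| ≤ Real.pi := by
    rw [abs_div, abs_of_pos (period_pos K μ)]
    exact le_trans (div_le_self (abs_nonneg _) (by exact_mod_cast Nat.pos_of_ne_zero (NeZero.ne (K μ)))) (hθ μ)
  have h := Real.cos_le_one_sub_mul_cos_sq hφ
  have : 4 / Real.pi ^ 2 * (θ μ / K μ) ^ 2 = 2 * (2 / Real.pi ^ 2 * (θ μ / K μ) ^ 2) := by ring
  rw [this]; linarith

omit hK in
/-- ★★ UPPER JORDAN BOUND: `holonomyGap K c θ ≤ c·Σ_μ(θ_μ∕K_μ)²` (every `θ`, `c ≥ 0`). [folklore] -/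
theorem holonomyGap_le_sq {c : ℝ} (hc : 0 ≤ c) (θ : Fin (d + 1) → ℝ) : holonomyGap K c θ ≤ c * ∑ μ, (θ μ / K μ) ^ 2 := by
  unfold holonomyGap
  rw [show 2 * c * ∑ μ, (1 - Real.cos (θ μ / K μ)) = c * ∑ μ, 2 * (1 - Real.cos (θ μ / K μ)) by rw [Finset.mul_sum, Finset.mul_sum]; exact Finset.sum_congr rfl fun μ _ => by ring]
  refine mul_le_mul_of_nonneg_left (Finset.sum_le_sum fun μ _ => ?_) hc
  have h := Real.one_sub_sq_div_two_le_cos (x := θ μ / K μ)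
  linarith

/-- With the mass: `m² + (4c∕π²)Σ(θ_μ∕K_μ)² ≤ Re(v^*Mv)∕Σ|v|²`-type coercivity — `(m² + (4c∕π²)Σ_μ(θ_μ∕K_μ)²)·Σ_x|v_x|² ≤ Re(v^*(−cΔ_ω+m²)v)`. [cite: King1986, (4.35) p.674] -/
theorem form_toronOp_ge_sq {c : ℝ} (hc : 0 ≤ c) (m2 : ℝ) {θ : Fin (d + 1) → ℝ} (hθ : ∀ μ, |θ μ| ≤ Real.pi) (v : Tor K → ℂ) :
    (m2 + 4 * c / Real.pi ^ 2 * ∑ μ, (θ μ / K μ) ^ 2) * ∑ x, ‖v x‖ ^ 2 ≤ (star v ⬝ᵥ (toronOp K c m2 (twistOf (redPhase K θ)) *ᵥ v)).re :=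
  le_trans (mul_le_mul_of_nonneg_right (by linarith [holonomyGap_ge_sq K hc hθ]) (Finset.sum_nonneg fun x _ => sq_nonneg _))
    (form_toronOp_ge_holonomyGap K hc m2 hθ v)

end Size

/-! ## §4 The η-rate of the holonomy gap and of the twisted dispersion -/

section EtaRate

variable {d : ℕ} (K : Fin (d + 1) → ℕ) [hK : ∀ μ, NeZero (K μ)]

/-- ★★★ **THE η-RATE OF THE HOLONOMY GAP**: `|holonomyGap K c θ − c·Σ_μ(θ_μ∕K_μ)²| ≤ (5∕48)·c·Σ_μ(θ_μ∕K_μ)⁴` whenever `|θ_μ| ≤ K_μ` (`c ≥ 0`).  In physical units (`c = η⁻²`,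
`K_μ = ℓ_μ∕η`): the continuum twisted Laplacian `−(∇ − iA)²` with the constant connection `A_μ = θ_μ∕ℓ_μ` on the torus of sides `ℓ_μ` has spectral bottom `Σ_μ(θ_μ∕ℓ_μ)²`, and the
lattice gap converges to it at rate `(5∕48)·η²·Σ_μ(θ_μ∕ℓ_μ)⁴ = O(η²)` — N15's η-rate for the one datum the curved case adds to the fine layer. [cite: King1986, (4.4) p.670, (4.7)-(4.10) p.671] -/
theorem abs_holonomyGap_sub_continuum_le {c : ℝ} (hc : 0 ≤ c) {θ : Fin (d + 1) → ℝ} (hθ : ∀ μ, |θ μ| ≤ K μ) :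
    |holonomyGap K c θ - c * ∑ μ, (θ μ / K μ) ^ 2| ≤ 5 / 48 * c * ∑ μ, (θ μ / K μ) ^ 4 := by
  unfold holonomyGap
  have hrw : 2 * c * ∑ μ, (1 - Real.cos (θ μ / K μ)) - c * ∑ μ, (θ μ / K μ) ^ 2 = c * ∑ μ, (2 * (1 - Real.cos (θ μ / K μ)) - (θ μ / K μ) ^ 2) := by
    rw [Finset.mul_sum, Finset.mul_sum, Finset.mul_sum, ← Finset.sum_sub_distrib]
    exact Finset.sum_congr rfl fun μ _ => by ring
  rw [hrw, abs_mul, abs_of_nonneg hc]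
  calc c * |∑ μ, (2 * (1 - Real.cos (θ μ / K μ)) - (θ μ / K μ) ^ 2)|
      ≤ c * ∑ μ, |2 * (1 - Real.cos (θ μ / K μ)) - (θ μ / K μ) ^ 2| := mul_le_mul_of_nonneg_left (Finset.abs_sum_le_sum_abs _ _) hc
    _ ≤ c * ∑ μ, 5 / 48 * (θ μ / K μ) ^ 4 := by
        refine mul_le_mul_of_nonneg_left (Finset.sum_le_sum fun μ _ => abs_two_mul_one_sub_cos_sub_sq_le ?_) hc
        rw [abs_div, abs_of_pos (period_pos K μ), div_le_one (period_pos K μ)]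
        exact hθ μ
    _ = 5 / 48 * c * ∑ μ, (θ μ / K μ) ^ 4 := by rw [← Finset.mul_sum]; ring

omit hK in
/-- ★★ **THE TWISTED DISPERSION RELATION AT RATE η²**: for every level `q` with `|p′_μ(q) + φ_μ| ≤ 1` (momenta small in lattice units),
`|lapSymTw K c m² φ q − (m² + c·Σ_μ(p′_μ(q) + φ_μ)²)| ≤ (5∕48)·c·Σ_μ(p′_μ(q) + φ_μ)⁴` — every twisted eigenvalue converges to the continuum one `m² + Σ_μk_μ²`,
`k_μ = (2πn_μ + θ_μ)∕ℓ_μ`, at rate `η²k⁴`. [cite: King1986, (4.4) p.670, (4.7)-(4.10) p.671] -/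
theorem abs_lapSymTw_sub_continuum_le {c : ℝ} (hc : 0 ≤ c) (m2 : ℝ) (φ : Fin (d + 1) → ℝ) (q : Tor K) (hq : ∀ μ, |sOf K q μ + φ μ| ≤ 1) :
    |lapSymTw K c m2 φ q - (m2 + c * ∑ μ, (sOf K q μ + φ μ) ^ 2)| ≤ 5 / 48 * c * ∑ μ, (sOf K q μ + φ μ) ^ 4 := by
  unfold lapSymTw
  have hrw : m2 + c * ∑ μ, (2 - 2 * Real.cos (sOf K q μ + φ μ)) - (m2 + c * ∑ μ, (sOf K q μ + φ μ) ^ 2)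
      = c * ∑ μ, (2 * (1 - Real.cos (sOf K q μ + φ μ)) - (sOf K q μ + φ μ) ^ 2) := by
    rw [Finset.mul_sum, Finset.mul_sum, Finset.mul_sum, add_sub_add_left_eq_sub, ← Finset.sum_sub_distrib]
    exact Finset.sum_congr rfl fun μ _ => by ring
  rw [hrw, abs_mul, abs_of_nonneg hc]
  calc c * |∑ μ, (2 * (1 - Real.cos (sOf K q μ + φ μ)) - (sOf K q μ + φ μ) ^ 2)|
      ≤ c * ∑ μ, |2 * (1 - Real.cos (sOf K q μ + φ μ)) - (sOf K q μ + φ μ) ^ 2| := mul_le_mul_of_nonneg_left (Finset.abs_sum_le_sum_abs _ _) hc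
    _ ≤ c * ∑ μ, 5 / 48 * (sOf K q μ + φ μ) ^ 4 := mul_le_mul_of_nonneg_left (Finset.sum_le_sum fun μ _ => abs_two_mul_one_sub_cos_sub_sq_le (hq μ)) hc
    _ = 5 / 48 * c * ∑ μ, (sOf K q μ + φ μ) ^ 4 := by rw [← Finset.mul_sum]; ring

omit hK in
/-- The one-sided form: the lattice gap never exceeds the continuum value `cΣ_μ(θ_μ∕K_μ)²` (Jordan, no smallness needed) … [folklore] -/
theorem holonomyGap_le_continuum {c : ℝ} (hc : 0 ≤ c) (θ : Fin (d + 1) → ℝ) : holonomyGap K c θ ≤ c * ∑ μ, (θ μ / K μ) ^ 2 :=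
  holonomyGap_le_sq K hc θ

/-- … and falls short of it by at most the quartic remainder: `cΣ_μ(θ_μ∕K_μ)² − (5∕48)cΣ_μ(θ_μ∕K_μ)⁴ ≤ holonomyGap` (`|θ_μ| ≤ K_μ`). [cite: King1986, (4.4) p.670] -/
theorem continuum_sub_le_holonomyGap {c : ℝ} (hc : 0 ≤ c) {θ : Fin (d + 1) → ℝ} (hθ : ∀ μ, |θ μ| ≤ K μ) :
    c * ∑ μ, (θ μ / K μ) ^ 2 - 5 / 48 * c * ∑ μ, (θ μ / K μ) ^ 4 ≤ holonomyGap K c θ := by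
  have h := abs_holonomyGap_sub_continuum_le K hc hθ
  rw [abs_le] at h
  linarith [h.1]

end EtaRate

end Summit.QuantumFields.YangMills.BalabanUVNodes.N15KingModelRung.Toron

end
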